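import Summits.CriticalPhenomena.Ising3DConformalLimit.Theorems.LeeYangGapNearCriticalLeeYangGapFirstZeroRateCharacterisation
import Literature.Probability.LatticeModels.LeeYangFirstZeroLimitDerivatives
import Literature.Probability.LatticeModels.LeeYangFirstZeroStrip
import Literature.Probability.LatticeModels.UrsellMonotonicityAllOrders

/-!
# Near-critical Lee–Yang gap — the Yang–Lee edge lies below every cube's first zero, and
# edge hyperscaling on cubes implies the route's EDGE

Route `LeeYangGap` (Ising3DConformalLimit), crux `NearCriticalLeeYangGap` (GAP, item
stmt-CriticalPhenomena-4945), line `registered`, lead c6; companion of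
`…FirstZeroRateCharacterisation.lean` (p165482).

* `mul_le_firstZero_of_magnetization_strip` — **the Yang–Lee edge is below every cube's first
  Lee–Yang zero, unconditionally** (`d ≥ 2`, `0 < β < β_c(d)`): if the magnetisation `h ↦ m(β,h)`
  (`h ≥ 0`) is the restriction of a function holomorphic on the strip `{|Im h| < θ}`, then
  `β·θ ≤ α₁(B_n,β)` for EVERY box `B_n` (Jiang–Newman's normalisation `Z_{Λ,β,h} = Σ e^{βΣσσ + hΣσ}`,
  field `= β ×` the physical one). Proof: `f_β' (t) = m(β,t/β)` for `t > 0` (tree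
  `deriv_freeEnergy_eq_freeCorr`, `freeCorr_eq_plusCorr_singleton_of_pos_holds`) and `f_β ∈ C^∞`
  (tree `contDiff_freeEnergy`, Lebowitz bounds), so `f_β^{(m+1)}(0) = Re Ψ^{(m)}(0)` with
  `Ψ(z) = F(z/β)` holomorphic on `|z| < βθ` (one-sided matching as `t ↓ 0`, no parity argument);
  Cauchy's estimates give `|f_β^{(2k)}(0)| ≤ (2k)!·(M'ρ')·ρ'^{-2k}` for `ρ' < βθ`, and Jiang–Newman's
  `1/α₁(B_n) = limsup_k [|u_{2k}(M_{B_n})|/(2k)!]^{1/(2k)}` with CJN superadditivity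
  `|u_{2k}(M_{B_n})| ≤ (2n+2)^d |f_β^{(2k)}(0)|` (tree `inv_firstZero_eq_limsup`,
  `abs_magnetizationCumulant_le_of_tendsto`, `tendsto_magnetizationCumulant_div_card_of_lt_criticalBeta`,
  `CamiaJiangNewman2023_thm1_holds`) finishes exactly as in the tree's
  `le_firstZero_of_thm1_of_analyticOnDisc` — whose disc hypothesis (Ott's analyticity) is NOT needed here.
* `stub_edgeOfCubeEdgeScaling` / `edge_of_cubeEdge` — **(II) ⟹ EDGE**: edge hyperscaling on free
  cubes beyond `K₀` correlation lengths, `α₁(Λ_L,β)²χξ³ ≤ C` (`L ≥ K₀ξ(β)`), implies the route's crux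
  EDGE `YangLeeEdgeHyperscaling` (item stmt-CriticalPhenomena-4946) with constant `4C/β_c²`. So (II)
  is a finite-volume STRENGTHENING of EDGE (a statement about classical partition-function zeros of
  cubes), usable by EDGE's own provers and disprovers.
* `firstZeroRate_and_edge_iff` — **S1r ∧ EDGE ⟺ (I) ∧ (II)** outright (with p165482 and c5's
  p162060): the two Lee–Yang inputs of line `registered` are, jointly, exactly two-sided edge
  hyperscaling `c ≤ α₁(Λ_L,β)²·χ(β)·ξ(β)³ ≤ C` on all free cubes from `K₀` correlation lengths on.

No new definitions, no named facts, no `sorry`; serves item stmt-CriticalPhenomena-4945 (`--supports`).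

## References

* J. Jiang, C. M. Newman, CPAM 77 (2024) 1224–1234, Props. 2–3, Cor. 1 [JiangNewman2023];
  F. Camia, J. Jiang, C. M. Newman, arXiv:2207.12247, Thm 1 [CamiaJiangNewman2023];
  S. Friedli, Y. Velenik, CUP 2017, Prop. 3.29, Thm. 3.34 [FriedliVelenik2017];
  J. L. Lebowitz, CMP 28 (1972) 313–321 [Lebowitz1972].
-/

noncomputable section

namespace Summit.CriticalPhenomena.Ising3DConformalLimit.LeeYangGapNearCriticalLeeYangGap

open Filter Finset Topology
open Literature.Probability.LatticeModels
open Literature.Probability.LatticeModels.JiangNewman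
open Summit.CriticalPhenomena.Ising3DConformalLimit.Theses.LeeYangGap (YangLeeEdgeHyperscaling)

/-! ### The Yang–Lee edge is below every cube's first zero -/

/-- `⟨σ₀⟩⁺_{β,h} = m(β,h)`: the plus correlation of the singleton `{0}` is the magnetisation. -/
theorem plusCorr_singleton_zero_eq_magnetizationInField (d : ℕ) (β h : ℝ) :
    plusCorr d β h {0} = magnetizationInField d β h := by
  rw [plusCorr, magnetizationInField]
  congr 1
  funext s
  simp [spinProduct]

/-- **The Yang–Lee edge lies below every cube's first Lee–Yang zero** (`d ≥ 2`, `0 < β < β_c(d)`):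
if `F` is holomorphic on the strip `{|Im z| < θ}` and `F(h) = m(β,h)` for all real `h ≥ 0`, then
`β·θ ≤ α₁(B_n,β)` for every `n` (Jiang–Newman normalisation). [JiangNewman2023 Props. 2–3, Cor. 1;
FriedliVelenik2017 Prop. 3.29; Lebowitz1972] -/
theorem mul_le_firstZero_of_magnetization_strip {d : ℕ} (hd : 2 ≤ d) {β : ℝ} (hβ : 0 < β)
    (hβc : β < criticalBeta d) {θ : ℝ} (hθ : 0 < θ) {F : ℂ → ℂ}
    (hF : DifferentiableOn ℂ F {z : ℂ | |z.im| < θ})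
    (hFm : ∀ h : ℝ, 0 ≤ h → F (h : ℂ) = ((magnetizationInField d β h : ℝ) : ℂ)) (n : ℕ) :
    β * θ ≤ firstZero d (box d n) β := by
  have hd1 : 1 ≤ d := le_trans (by norm_num) hd
  have hne := box_nonempty d n
  have hα0 : 0 < firstZero d (box d n) β := (firstZero_spec hβ.le hne).1
  set ρ : ℝ := β * θ with hρdef
  have hρ : 0 < ρ := mul_pos hβ hθ
  set g : ℝ → ℝ := JiangNewman.freeEnergy d β with hgdef
  -- `Ψ(z) = F(z/β)`, holomorphic on the disc `|z| < βθ`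
  set Ψ : ℂ → ℂ := fun z => F (z / (β : ℂ)) with hΨdef
  set B : Set ℂ := Metric.ball (0 : ℂ) ρ with hBdef
  have hBo : IsOpen B := Metric.isOpen_ball
  have hΨ : DifferentiableOn ℂ Ψ B := by
    refine hF.comp (differentiableOn_id.div_const _) fun z hz => ?_
    have hz' : ‖z‖ < ρ := by simpa [hBdef] using hz
    show |(z / (β : ℂ)).im| < θ
    have him : (z / (β : ℂ)).im = z.im / β := by
      rw [Complex.div_ofReal_im]
    rw [him, abs_div, abs_of_pos hβ, div_lt_iff₀ hβ]
    calc |z.im| ≤ ‖z‖ := Complex.abs_im_le_norm z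
      _ < ρ := hz'
      _ = θ * β := by rw [hρdef, mul_comm]
  -- `g` is smooth and `g'(t) = Re Ψ(t)` for `0 < t < ρ`
  have hgC : ∀ m : ℕ, ContDiff ℝ m g := fun m => contDiff_freeEnergy hd hβ hβc m
  have hgdiff : Differentiable ℝ g := (hgC 1).differentiable (by norm_num)
  have hderiv : ∀ t : ℝ, 0 < t → deriv g t = (Ψ t).re := by
    intro t ht
    have hD : HasDerivAt g (deriv g t) t := (hgdiff t).hasDerivAt
    have h1 := deriv_freeEnergy_eq_freeCorr (d := d) hβ ht hD
    rw [h1, freeCorr_eq_plusCorr_singleton_of_pos_holds (d := d) hd1 hβ.le (div_pos ht hβ),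
      plusCorr_singleton_zero_eq_magnetizationInField]
    have hcast : ((t : ℝ) : ℂ) / (β : ℂ) = (((t / β : ℝ)) : ℂ) := by push_cast; ring
    show magnetizationInField d β (t / β) = (F (((t : ℝ) : ℂ) / (β : ℂ))).re
    rw [hcast, hFm (t / β) (div_pos ht hβ).le, Complex.ofReal_re]
  -- hence `g^{(m+1)}(t) = Re Ψ^{(m)}(t)` on `(0, ρ)` …
  have hstep : ∀ (m : ℕ) (t : ℝ), 0 < t → t < ρ →
      iteratedDeriv (m + 1) g t = (iteratedDeriv m Ψ t).re := by
    intro m t ht htρ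
    rw [iteratedDeriv_succ']
    have heq : deriv g =ᶠ[𝓝 t] fun s : ℝ => (Ψ s).re := by
      filter_upwards [Ioi_mem_nhds ht] with s hs
      exact hderiv s hs
    rw [heq.iteratedDeriv_eq m]
    exact iteratedDeriv_re_ofReal_eq hΨ m (by rw [abs_of_pos ht]; exact htρ)
  -- … and at `t = 0`, by continuity from the right (no parity argument is needed)
  have hzero : ∀ m : ℕ, iteratedDeriv (m + 1) g 0 = (iteratedDeriv m Ψ 0).re := by
    intro m
    have h1 : Tendsto (iteratedDeriv (m + 1) g) (𝓝[>] 0) (𝓝 (iteratedDeriv (m + 1) g 0)) :=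
      (((hgC (m + 1)).continuous_iteratedDeriv (m + 1) le_rfl).tendsto 0).mono_left
        nhdsWithin_le_nhds
    -- iterated complex derivatives of `Ψ` are holomorphic, hence continuous, on the disc
    have hΨdiff : ∀ j : ℕ, DifferentiableOn ℂ (iteratedDeriv j Ψ) B := by
      intro j
      induction j with
      | zero => simpa using hΨ
      | succ j ih => rw [iteratedDeriv_succ]; exact ih.deriv hBo
    have hΨm : ContinuousOn (iteratedDeriv m Ψ) B := (hΨdiff m).continuousOn
    have h0B : ((0 : ℝ) : ℂ) ∈ B := by simp [hBdef, hρ]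
    have hcont : ContinuousAt (fun s : ℝ => (iteratedDeriv m Ψ s).re) 0 := by
      have hc1 : ContinuousAt (iteratedDeriv m Ψ) ((0 : ℝ) : ℂ) :=
        hΨm.continuousAt (hBo.mem_nhds h0B)
      have hc2 : ContinuousAt (fun s : ℝ => iteratedDeriv m Ψ (s : ℂ)) 0 :=
        hc1.comp Complex.continuous_ofReal.continuousAt
      exact Complex.continuous_re.continuousAt.comp hc2
    have h2 : Tendsto (fun s : ℝ => (iteratedDeriv m Ψ s).re) (𝓝[>] 0)
        (𝓝 ((iteratedDeriv m Ψ ((0 : ℝ) : ℂ)).re)) :=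
      hcont.tendsto.mono_left nhdsWithin_le_nhds
    have heq : ∀ᶠ s in 𝓝[>] (0 : ℝ), iteratedDeriv (m + 1) g s = (iteratedDeriv m Ψ s).re := by
      filter_upwards [Ioo_mem_nhdsGT hρ] with s hs
      exact hstep m s hs.1 hs.2
    have := tendsto_nhds_unique (h1.congr' heq) h2
    simpa using this
  -- `1/α₁(B_n) = limsup v`
  set v : ℕ → ℝ := fun k => (|magnetizationCumulant d (box d n) β (2 * k)| /
    ((2 * k).factorial : ℝ)) ^ ((1 : ℝ) / (2 * k)) with hv
  have hv0 : ∀ k, 0 ≤ v k := fun k => Real.rpow_nonneg (by positivity) _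
  have hveq : (firstZero d (box d n) β)⁻¹ = limsup v atTop := inv_firstZero_eq_limsup hβ.le hne
  -- it suffices to prove `α₁(B_n) ≥ ρ₁` for every `ρ₁ < ρ`
  refine le_of_forall_lt_imp_le_of_dense fun ρ₁ hρ₁ => ?_
  rcases le_or_gt ρ₁ 0 with hρ₁0 | hρ₁0
  · exact hρ₁0.trans hα0.le
  obtain ⟨ρ', hρ'1, hρ'2⟩ := exists_between hρ₁
  have hρ'0 : 0 < ρ' := hρ₁0.trans hρ'1
  -- Cauchy's estimates for `Ψ` on the circle of radius `ρ'`
  have hsph : Metric.sphere (0 : ℂ) ρ' ⊆ B :=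
    Metric.sphere_subset_closedBall.trans (Metric.closedBall_subset_ball hρ'2)
  obtain ⟨M, hM⟩ : ∃ M, ∀ w ∈ Metric.sphere (0 : ℂ) ρ', ‖Ψ w‖ ≤ M :=
    (isCompact_sphere (0 : ℂ) ρ').exists_bound_of_continuousOn (hΨ.continuousOn.mono hsph)
  set M' : ℝ := max M 1 with hM'
  have hM'0 : 0 < M' := lt_max_of_lt_right one_pos
  have hM'b : ∀ w ∈ Metric.sphere (0 : ℂ) ρ', ‖Ψ w‖ ≤ M' := fun w hw => (hM w hw).trans (le_max_left _ _)
  have hdc : DiffContOnCl ℂ Ψ (Metric.ball 0 ρ') := by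
    refine DifferentiableOn.diffContOnCl ?_
    rw [closure_ball _ hρ'0.ne']
    exact hΨ.mono (Metric.closedBall_subset_ball hρ'2)
  have hcauchy : ∀ m, ‖iteratedDeriv m Ψ 0‖ ≤ (m.factorial : ℝ) * M' / ρ' ^ m := fun m =>
    Complex.norm_iteratedDeriv_le_of_forall_mem_sphere_norm_le m hρ'0 hdc hM'b
  -- `|f^{(2k)}(0)| ≤ (2k)! (M'ρ') / ρ'^{2k}` for `k ≥ 1`
  set M'' : ℝ := M' * ρ' with hM''
  have hM''0 : 0 < M'' := mul_pos hM'0 hρ'0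
  have hf : ∀ k : ℕ, 1 ≤ k →
      |iteratedDeriv (2 * k) g 0| ≤ ((2 * k).factorial : ℝ) * M'' / ρ' ^ (2 * k) := by
    intro k hk
    obtain ⟨m, hm⟩ : ∃ m : ℕ, 2 * k = m + 1 := ⟨2 * k - 1, by omega⟩
    rw [hm, hzero m]
    have h1 : |(iteratedDeriv m Ψ 0).re| ≤ (m.factorial : ℝ) * M' / ρ' ^ m :=
      (Complex.abs_re_le_norm _).trans (hcauchy m)
    have hfac : (m.factorial : ℝ) ≤ ((m + 1).factorial : ℝ) := by
      exact_mod_cast Nat.factorial_le (Nat.le_succ m)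
    have hpow : ρ' ^ (m + 1) = ρ' ^ m * ρ' := pow_succ ρ' m
    rw [hpow, hM'']
    calc |(iteratedDeriv m Ψ 0).re| ≤ (m.factorial : ℝ) * M' / ρ' ^ m := h1
      _ = (m.factorial : ℝ) * (M' * ρ') / (ρ' ^ m * ρ') := by
          field_simp
      _ ≤ ((m + 1).factorial : ℝ) * (M' * ρ') / (ρ' ^ m * ρ') := by
          gcongr
  -- the constant `K = (2n+2)^d M''` and `v k ≤ K^{1/(2k)}/ρ'`
  set K : ℝ := (2 * n + 2 : ℝ) ^ d * M'' with hK
  have hK0 : 0 < K := by rw [hK]; positivity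
  have hvle : ∀ k : ℕ, 1 ≤ k → v k ≤ K ^ ((1 : ℝ) / (2 * k)) * ρ'⁻¹ := by
    intro k hk
    have h2k0 : (2 * k : ℕ) ≠ 0 := by omega
    have hfacpos : (0 : ℝ) < ((2 * k).factorial : ℝ) := by positivity
    have hn0 : (0 : ℝ) < (2 * n + 2 : ℝ) ^ d := by positivity
    have hT := tendsto_magnetizationCumulant_div_card_of_lt_criticalBeta hd hβ.le hβc (2 * k)
    have hA := abs_magnetizationCumulant_le_of_tendsto CamiaJiangNewman2023_thm1_holds hβ.le hk hT n
    have hu : |magnetizationCumulant d (box d n) β (2 * k)| / ((2 * k).factorial : ℝ) ≤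
        K / ρ' ^ (2 * k) := by
      rw [div_le_iff₀ hfacpos]
      have h := (inv_mul_le_iff₀ hn0).1 (hA.trans (hf k hk))
      calc |magnetizationCumulant d (box d n) β (2 * k)|
          ≤ (2 * n + 2 : ℝ) ^ d * (((2 * k).factorial : ℝ) * M'' / ρ' ^ (2 * k)) := h
        _ = K / ρ' ^ (2 * k) * ((2 * k).factorial : ℝ) := by rw [hK]; ring
    calc v k ≤ (K / ρ' ^ (2 * k)) ^ ((1 : ℝ) / (2 * k)) :=
          Real.rpow_le_rpow (by positivity) hu (by positivity)
      _ = K ^ ((1 : ℝ) / (2 * k)) * (ρ' ^ (2 * k))⁻¹ ^ ((1 : ℝ) / (2 * k)) := by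
          rw [div_eq_mul_inv, Real.mul_rpow hK0.le (by positivity)]
      _ = K ^ ((1 : ℝ) / (2 * k)) * ρ'⁻¹ := by
          congr 1
          rw [← inv_pow, show ((1 : ℝ) / (2 * k)) = ((2 * k : ℕ) : ℝ)⁻¹ by push_cast; ring]
          exact Real.pow_rpow_inv_natCast (inv_nonneg.2 hρ'0.le) h2k0
  -- `K^{1/(2k)} → 1`, so eventually `v k ≤ 1/ρ₁`, whence `1/α₁(B_n) ≤ 1/ρ₁`
  have hexp0 : Tendsto (fun k : ℕ => (1 : ℝ) / (2 * k)) atTop (𝓝 0) := by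
    have h1' : Tendsto (fun k : ℕ => (2 : ℝ) * k) atTop atTop :=
      (tendsto_natCast_atTop_atTop (R := ℝ)).const_mul_atTop two_pos
    exact tendsto_const_nhds.div_atTop h1'
  have hKk : Tendsto (fun k : ℕ => K ^ ((1 : ℝ) / (2 * k))) atTop (𝓝 1) := by
    have hcont : ContinuousAt (fun x : ℝ => K ^ x) 0 := Real.continuousAt_const_rpow hK0.ne'
    have := hcont.tendsto.comp hexp0
    rw [Real.rpow_zero] at this
    exact this
  have hwk : Tendsto (fun k : ℕ => K ^ ((1 : ℝ) / (2 * k)) * ρ'⁻¹) atTop (𝓝 (1 * ρ'⁻¹)) :=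
    hKk.mul_const _
  rw [one_mul] at hwk
  have hlt : ρ'⁻¹ < ρ₁⁻¹ := (inv_lt_inv₀ hρ'0 hρ₁0).2 hρ'1
  have hev : ∀ᶠ k in atTop, v k ≤ ρ₁⁻¹ := by
    filter_upwards [hwk.eventually (eventually_lt_nhds hlt), eventually_ge_atTop 1] with k hk hk1
    exact (hvle k hk1).trans hk.le
  have hlimsup : limsup v atTop ≤ ρ₁⁻¹ := limsup_le_of_le (isCoboundedUnder_le_of_le atTop hv0) hev
  rw [← hveq] at hlimsup
  exact (inv_le_inv₀ hα0 hρ₁0).1 hlimsup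

/-! ### (II) ⟹ EDGE -/

/-- **Edge hyperscaling on cubes implies the route's EDGE** (`YangLeeEdgeHyperscaling`, item
stmt-CriticalPhenomena-4946): if `α₁(Λ_L,β)²·χ(β)·ξ(β)³ ≤ C` for all `β ∈ [β₀,β_c)` and all cubes
`L ≥ K₀ξ(β)`, then for `β ∈ [max β₀ (β_c/2), β_c)` and every `θ > 0` such that `m(β,·)` extends
holomorphically to `{|Im h| < θ}`, `θ²χξ³ ≤ 4C/β_c²` (`βθ ≤ α₁(Λ_L,β)` at `L = ⌈K₀ξ(β)⌉₊` by
`mul_le_firstZero_of_magnetization_strip`). -/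
theorem edge_of_cubeEdge
    (hII : ∃ C K₀ β₀ : ℝ, 0 < K₀ ∧ β₀ < criticalBeta 3 ∧ ∀ β : ℝ, β₀ ≤ β → β < criticalBeta 3 →
      ∀ L : ℕ, K₀ * isingCorrLength 3 β ≤ (L : ℝ) →
        JiangNewman.firstZero 3 (box 3 L) β ^ 2 * (susceptibility 3 β).toReal *
          isingCorrLength 3 β ^ 3 ≤ C) :
    YangLeeEdgeHyperscaling := by
  obtain ⟨C, K₀, β₀, hK₀, hβ₀, hII⟩ := hII
  have hβc : 0 < criticalBeta 3 := criticalBeta_pos_holds (d := 3) (by norm_num)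
  refine ⟨4 * C / criticalBeta 3 ^ 2 ⊔ 0, max β₀ (criticalBeta 3 / 2), max_lt hβ₀ (by linarith),
    fun β θ hβ hββc hθ hF => ?_⟩
  obtain ⟨F, hF, hFm⟩ := hF
  have hβ₀β : β₀ ≤ β := (le_max_left _ _).trans hβ
  have hβhalf : criticalBeta 3 / 2 ≤ β := (le_max_right _ _).trans hβ
  have hβpos : 0 < β := lt_of_lt_of_le (by linarith) hβhalf
  set L : ℕ := ⌈K₀ * isingCorrLength 3 β⌉₊ with hL
  have hKL : K₀ * isingCorrLength 3 β ≤ (L : ℝ) := Nat.le_ceil _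
  have hcube := hII β hβ₀β hββc L hKL
  have hedge : β * θ ≤ JiangNewman.firstZero 3 (box 3 L) β :=
    mul_le_firstZero_of_magnetization_strip (d := 3) (by norm_num) hβpos hββc hθ hF hFm L
  have hP0 : 0 ≤ (susceptibility 3 β).toReal * isingCorrLength 3 β ^ 3 :=
    mul_nonneg ENNReal.toReal_nonneg (pow_nonneg (isingCorrLength_pos hβpos hββc).le 3)
  have hC0 : 0 ≤ C := by
    refine le_trans ?_ hcube
    rw [mul_assoc]
    exact mul_nonneg (sq_nonneg _) hP0
  -- `θ²χξ³ = (βθ)²χξ³/β² ≤ α₁²χξ³/β² ≤ C/β² ≤ 4C/β_c²`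
  have h1 : (β * θ) ^ 2 * ((susceptibility 3 β).toReal * isingCorrLength 3 β ^ 3) ≤ C := by
    calc (β * θ) ^ 2 * ((susceptibility 3 β).toReal * isingCorrLength 3 β ^ 3)
        ≤ JiangNewman.firstZero 3 (box 3 L) β ^ 2 *
            ((susceptibility 3 β).toReal * isingCorrLength 3 β ^ 3) :=
          mul_le_mul_of_nonneg_right (pow_le_pow_left₀ (by positivity) hedge 2) hP0
      _ ≤ C := by rw [← mul_assoc]; exact hcube
  refine le_trans ?_ (le_max_left _ _)
  rw [le_div_iff₀ (pow_pos hβc 2)]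
  have h2 : θ ^ 2 * (susceptibility 3 β).toReal * isingCorrLength 3 β ^ 3 * β ^ 2 ≤ C := by
    calc θ ^ 2 * (susceptibility 3 β).toReal * isingCorrLength 3 β ^ 3 * β ^ 2
        = (β * θ) ^ 2 * ((susceptibility 3 β).toReal * isingCorrLength 3 β ^ 3) := by ring
      _ ≤ C := h1
  have h3 : criticalBeta 3 ^ 2 ≤ 4 * β ^ 2 := by nlinarith
  have h4 : 0 ≤ θ ^ 2 * (susceptibility 3 β).toReal * isingCorrLength 3 β ^ 3 := by
    have := mul_nonneg (sq_nonneg θ) hP0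
    simpa [mul_assoc] using this
  calc θ ^ 2 * (susceptibility 3 β).toReal * isingCorrLength 3 β ^ 3 * criticalBeta 3 ^ 2
      ≤ θ ^ 2 * (susceptibility 3 β).toReal * isingCorrLength 3 β ^ 3 * (4 * β ^ 2) :=
        mul_le_mul_of_nonneg_left h3 h4
    _ = 4 * (θ ^ 2 * (susceptibility 3 β).toReal * isingCorrLength 3 β ^ 3 * β ^ 2) := by ring
    _ ≤ 4 * C := by linarith

/-! ### S1r ∧ EDGE ⟺ (I) ∧ (II) -/

/-- **The two Lee–Yang inputs of line `registered` are, jointly, exactly two-sided edge hyperscaling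
on free cubes**: `S1r ∧ EDGE ⟺ (I) ∧ (II)` (⟹: lead c5's anatomy p162060; ⟸: p165482's
`firstZeroRate_of_reverseEdge_of_cubeEdge` and `edge_of_cubeEdge`). -/
theorem firstZeroRate_and_edge_iff :
    ((∃ A K₀ β₀ : ℝ, 0 < A ∧ 0 < K₀ ∧ β₀ < Literature.Probability.LatticeModels.criticalBeta 3 ∧
      ∀ β : ℝ, β₀ ≤ β → β < Literature.Probability.LatticeModels.criticalBeta 3 → ∀ L : ℕ,
        K₀ * Literature.Probability.LatticeModels.isingCorrLength 3 β ≤ (L : ℝ) → ∀ n : ℕ,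
          Literature.Probability.LatticeModels.JiangNewman.firstZero 3
              (Literature.Probability.LatticeModels.box 3 L) β ≤
            A * Literature.Probability.LatticeModels.JiangNewman.firstZero 3
              (Literature.Probability.LatticeModels.box 3 n) β) ∧ YangLeeEdgeHyperscaling) ↔
    ((∃ c β₁ : ℝ, 0 < c ∧ β₁ < criticalBeta 3 ∧ ∀ β : ℝ, β₁ ≤ β → β < criticalBeta 3 → ∀ n : ℕ,
        c ≤ JiangNewman.firstZero 3 (box 3 n) β ^ 2 * (susceptibility 3 β).toReal *
          isingCorrLength 3 β ^ 3) ∧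
      (∃ C K₀ β₀ : ℝ, 0 < K₀ ∧ β₀ < criticalBeta 3 ∧ ∀ β : ℝ, β₀ ≤ β → β < criticalBeta 3 →
        ∀ L : ℕ, K₀ * isingCorrLength 3 β ≤ (L : ℝ) →
          JiangNewman.firstZero 3 (box 3 L) β ^ 2 * (susceptibility 3 β).toReal *
            isingCorrLength 3 β ^ 3 ≤ C)) :=
  ⟨fun h => (firstZeroRate_iff_of_edge h.2).1 h.1,
    fun h => ⟨firstZeroRate_of_reverseEdge_of_cubeEdge h.1 h.2, edge_of_cubeEdge h.2⟩⟩

/-! ### Registered form -/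

/-- **`stub_edgeOfCubeEdgeScaling` — (II) ⟹ EDGE** (registered anatomy stub of line `registered`,
verbatim; it is `edge_of_cubeEdge`): edge hyperscaling on free cubes beyond `K₀` correlation lengths
implies the route item `YangLeeEdgeHyperscaling` (stmt-CriticalPhenomena-4946), by name. -/
theorem stub_edgeOfCubeEdgeScaling :
    (∃ C K₀ β₀ : ℝ, 0 < K₀ ∧ β₀ < Literature.Probability.LatticeModels.criticalBeta 3 ∧ ∀ β : ℝ, β₀ ≤ β → β < Literature.Probability.LatticeModels.criticalBeta 3 → ∀ L : ℕ, K₀ * Literature.Probability.LatticeModels.isingCorrLength 3 β ≤ (L : ℝ) → Literature.Probability.LatticeModels.JiangNewman.firstZero 3 (Literature.Probability.LatticeModels.box 3 L) β ^ 2 * (Literature.Probability.LatticeModels.susceptibility 3 β).toReal * Literature.Probability.LatticeModels.isingCorrLength 3 β ^ 3 ≤ C) → Summit.CriticalPhenomena.Ising3DConformalLimit.Theses.LeeYangGap.YangLeeEdgeHyperscaling :=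
  edge_of_cubeEdge

end Summit.CriticalPhenomena.Ising3DConformalLimit.LeeYangGapNearCriticalLeeYangGap

end
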